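import Literature.Geometry.Riemannian.SharpLogSobolevAVR
import Literature.Geometry.Riemannian.GaussianShrinker
import Literature.Analysis.FunctionSpaces.EuclideanLogSobolev
import Mathlib.MeasureTheory.Measure.Lebesgue.VolumeOfBalls
import HarnessLib

/-!
# The sharp log-Sobolev inequality under `Ric ≥ 0`, `AVR > 0`: the flat model `(ℝ⁴, δ)`, `θ = 1`

Topic `Literature/Geometry/Riemannian`; companion of `SharpLogSobolevAVR.lean` (the named fact
`sharpLogSobolevAVR_four`, Balogh–Kristály–Tripaldi 2024, Thm. 1.1 with `p = 2`, `N = n = 4`) and of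
`SharpLogSobolevAVRProofs.lean`.

What is here. The named fact quantifies over all complete Riemannian `4`-manifolds with `Ric ≥ 0`
and asymptotic volume ratio `θ > 0`. This file PROVES its instance on the model space: Euclidean
`ℝ⁴ = EuclideanFour` with the tree's Euclidean metric `euclideanMetric EuclideanFour`
(`RoundSphere.lean`, `GaussianShrinker.lean`), where `θ = AVR = 1` and the inequality is the sharp
Euclidean logarithmic Sobolev inequality of Weissler and Carlen in the scale form
`∫ u² log u² dx ≤ 4τ ∫ |∇u|² dx − 2 log(4πτ) − 4` (Bakry–Gentil–Ledoux 2014, Prop. 6.2.5), proved in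
`Literature.Analysis.FunctionSpaces.euclideanLogSobolev_scale_four`. Precisely:

* `gradSq_euclideanMetric` — the tree's gradient square `g⁻¹(du, du)` of the Euclidean metric is
  `‖Du‖²` (the dual norm of the Fréchet derivative);
* `avr_euclideanFour` — **`AVR(ℝ⁴) = 1`** in the fact's normalisation:
  `vol{y : d(x,y) ≤ r} / (π²/2 · r⁴) → 1` (`|B_r| = π² r⁴ / 2`, Mathlib's `EuclideanSpace.volume_closedBall`,
  and `dV_δ = dx`, `GaussianShrinker.riemannianMeasure_euclideanFour`);
* `sharpLogSobolevAVR_four_euclideanFour` — the conclusion of `sharpLogSobolevAVR_four` for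
  `(ℝ⁴, δ)`, `θ = 1`, every `u ∈ C^∞_c(ℝ⁴)` with `∫ u² dV = 1` and every `τ > 0`;
* `sharpLogSobolevAVR_four_flatModel` — the four hypotheses of the fact (closed balls compact,
  `Ric ≥ 0`, `θ > 0`, the volume-ratio limit) AND its conclusion, all proved for the flat model: the
  fact's universally quantified body holds at `P = ℝ⁴`, `h = δ`, `θ = 1`.

This is the equality case of the theorem ("(1.4) on `ℝⁿ`", Balogh–Kristály–Tripaldi 2024, p. 2, due to
Weissler 1978 / Carlen 1991) and a machine-checked certificate that the tree's rendering of the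
constants (`riemannianMeasure`, `gradSq`, `π²/2 · r⁴`) is the printed one. Everything is proved; no
definitions, no named facts. What is NOT here: any non-flat case of `sharpLogSobolevAVR_four`.

## References

* [BaloghKristalyTripaldi2024] Z. M. Balogh, A. Kristály, F. Tripaldi, *Sharp log-Sobolev
  inequalities in `CD(0,N)` spaces with applications*, J. Funct. Anal. 286 (2024) 110217,
  arXiv:2210.15774: Thm. 1.1 and (1.4) (pp. 2–3). READ.
* [BakryGentilLedoux2014] D. Bakry, I. Gentil, M. Ledoux, Springer 2014: Prop. 6.2.5 (p. 284).
-/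

noncomputable section

open Bundle Set Function Filter MeasureTheory Manifold
open scoped ContDiff Topology ENNReal NNReal RealInnerProductSpace

namespace Literature.Geometry.Riemannian

open Lorentzian Lorentzian.PseudoRiemannianMetric Literature.Analysis.FunctionSpaces

/-! ### The gradient square of the Euclidean metric -/

section General

variable {W : Type*} [NormedAddCommGroup W] [InnerProductSpace ℝ W] [FiniteDimensional ℝ W]

omit [FiniteDimensional ℝ W] in
/-- `mvfderiv` on a vector space is `fderiv` (private copy, as in `GaussianShrinker.lean`). [folklore] -/
private theorem mvfderiv_vectorSpace_apply'' {F : Type*} [NormedAddCommGroup F] [NormedSpace ℝ F]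
    (f : W → F) (x v : W) :
    mvfderiv 𝓘(ℝ, W) f x v = fderiv ℝ f x v := by
  simp only [mvfderiv, mfderiv_eq_fderiv]
  rfl

/-- **`g⁻¹(du, du) = |∇u|²` for the Euclidean metric**: the tree's gradient square
(`PseudoRiemannianMetric.gradSq`, `dψ(♯dψ)`) of `euclideanMetric W` is the squared dual norm of the
Fréchet derivative, `‖Du_x‖²` (Riesz: `♯ du = ∇u`, `du(∇u) = |∇u|²`). [folklore] -/
theorem gradSq_euclideanMetric (u : W → ℝ) (x : W) :
    (euclideanMetric W).gradSq u x = ‖fderiv ℝ u x‖ ^ 2 := by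
  haveI : CompleteSpace W := FiniteDimensional.complete ℝ W
  rw [PseudoRiemannianMetric.gradSq_eq]
  set α : TangentSpace 𝓘(ℝ, W) x →L[ℝ] ℝ := mvfderiv 𝓘(ℝ, W) u x with hα
  set s : W := (euclideanMetric W).sharp x (α : TangentSpace 𝓘(ℝ, W) x →ₗ[ℝ] ℝ) with hs
  have hsw : ∀ w : W, ⟪s, w⟫ = α w := fun w ↦ by
    have h1 := (euclideanMetric W).val_sharp_apply x (α : TangentSpace 𝓘(ℝ, W) x →ₗ[ℝ] ℝ) w
    rw [euclideanMetric_apply] at h1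
    exact h1
  have hαf : ∀ v : W, α v = fderiv ℝ u x v := fun v ↦ mvfderiv_vectorSpace_apply'' u x v
  have hs' : s = (InnerProductSpace.toDual ℝ W).symm (fderiv ℝ u x) := by
    apply ext_inner_right ℝ
    intro w
    rw [hsw, InnerProductSpace.toDual_symm_apply, hαf]
  change α s = ‖fderiv ℝ u x‖ ^ 2
  rw [← hsw s, real_inner_self_eq_norm_sq, hs', LinearIsometryEquiv.norm_map]

end General

/-! ### The flat model `(ℝ⁴, δ)`: `AVR = 1` and the sharp inequality -/

section EuclideanFour

/-- Closed `δ`-balls of `ℝ⁴` in the fact's spelling are the closed Euclidean balls. [folklore] -/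
theorem setOf_edist_euclideanFour_le (x : EuclideanFour) {r : ℝ} (hr : 0 ≤ r) :
    {y : EuclideanFour | (euclideanMetric EuclideanFour).edist isRiemannian_euclideanMetric x y ≤
      ENNReal.ofReal r} = Metric.closedBall x r := by
  ext y
  rw [mem_setOf_eq, edist_euclideanMetric, Metric.mem_closedBall, PseudoEMetricSpace.edist_comm,
    edist_le_ofReal hr]

/-- `|B̄_r| = (π²/2) r⁴` in `ℝ⁴` for the tree's Riemannian measure of the Euclidean metric
(`dV_δ = dx` and Mathlib's volume of Euclidean balls, `Γ(3) = 2`). [folklore] -/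
theorem riemannianMeasure_euclideanFour_closedBall_toReal (x : EuclideanFour) {r : ℝ} (hr : 0 ≤ r) :
    ((riemannianMeasure euclideanFourMetric)
        {y : EuclideanFour | (euclideanMetric EuclideanFour).edist isRiemannian_euclideanMetric x y ≤
          ENNReal.ofReal r}).toReal = Real.pi ^ 2 / 2 * r ^ 4 := by
  rw [setOf_edist_euclideanFour_le x hr, riemannianMeasure_euclideanFour,
    EuclideanSpace.volume_closedBall, Fintype.card_fin, ENNReal.toReal_mul, ENNReal.toReal_pow,
    ENNReal.toReal_ofReal hr]
  have hG : Real.Gamma ((4 : ℕ) / 2 + 1 : ℝ) = 2 := by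
    rw [show ((4 : ℕ) / 2 + 1 : ℝ) = (2 : ℕ) + 1 by norm_num, Real.Gamma_nat_eq_factorial]
    norm_num [Nat.factorial]
  have hs : Real.sqrt Real.pi ^ (4 : ℕ) = Real.pi ^ 2 := by
    rw [show (4 : ℕ) = 2 * 2 from rfl, pow_mul, Real.sq_sqrt Real.pi_pos.le]
  rw [hG, hs, ENNReal.toReal_ofReal (by positivity)]
  ring

/-- **`AVR(ℝ⁴, δ) = 1`** in the normalisation of `sharpLogSobolevAVR_four`:
`vol_δ{y : d(x, y) ≤ r} / (π²/2 · r⁴) → 1` as `r → ∞` (the ratio is identically `1` for `r > 0`).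
[cite: BaloghKristalyTripaldi2024, §1 p. 2 (AVR, "equality for ℝⁿ")] -/
theorem avr_euclideanFour (x : EuclideanFour) :
    Tendsto (fun r : ℝ ↦ ((riemannianMeasure euclideanFourMetric)
        {y : EuclideanFour | (euclideanMetric EuclideanFour).edist isRiemannian_euclideanMetric x y ≤
          ENNReal.ofReal r}).toReal / (Real.pi ^ 2 / 2 * r ^ 4)) atTop (𝓝 1) := by
  refine (tendsto_const_nhds (x := (1 : ℝ))).congr' ?_
  filter_upwards [eventually_gt_atTop (0 : ℝ)] with r hr
  rw [riemannianMeasure_euclideanFour_closedBall_toReal x hr.le, div_self]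
  positivity

/-- **The sharp log-Sobolev inequality on the flat model.** For `u ∈ C^∞_c(ℝ⁴)` with
`∫ u² dV_δ = 1` and `τ > 0`,
`∫ u² log u² dV_δ ≤ 4τ ∫ g⁻¹(du,du) dV_δ − log 1 − 2 log(4πτ) − 4`:
the conclusion of `sharpLogSobolevAVR_four` at `P = ℝ⁴`, `h = δ`, `θ = 1`, i.e. the sharp Euclidean
logarithmic Sobolev inequality (Weissler, Carlen; Bakry–Gentil–Ledoux 2014, Prop. 6.2.5, here
`euclideanLogSobolev_scale_four`) transported to the tree's Riemannian vocabulary by `dV_δ = dx` and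
`g⁻¹(du,du) = |∇u|²`.
[cite: BaloghKristalyTripaldi2024, Thm. 1.1 and (1.4), pp. 2–3] -/
theorem sharpLogSobolevAVR_four_euclideanFour (u : EuclideanFour → ℝ)
    (hu : ContMDiff (𝓡 4) 𝓘(ℝ, ℝ) ∞ u) (hcu : HasCompactSupport u)
    (h1 : ∫ x, (u x) ^ 2 ∂(riemannianMeasure euclideanFourMetric) = 1) {τ : ℝ} (hτ : 0 < τ) :
    ∫ x, (u x) ^ 2 * Real.log ((u x) ^ 2) ∂(riemannianMeasure euclideanFourMetric) ≤
      4 * τ * ∫ x, (euclideanMetric EuclideanFour).gradSq u x ∂(riemannianMeasure euclideanFourMetric)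
        - Real.log 1 - 2 * Real.log (4 * Real.pi * τ) - 4 := by
  rw [riemannianMeasure_euclideanFour] at h1 ⊢
  simp_rw [gradSq_euclideanMetric]
  rw [Real.log_one, sub_zero]
  have hf : ContDiff ℝ 1 u := (contMDiff_iff_contDiff.1 hu).of_le (by exact_mod_cast le_top)
  exact euclideanLogSobolev_scale_four hf hcu h1 hτ

/-- **The flat model of `sharpLogSobolevAVR_four`.** Every hypothesis of the named fact
`Literature.Geometry.Riemannian.sharpLogSobolevAVR_four` — closed `g`-balls compact, `Ric ≥ 0`,
`θ > 0`, `vol_g(B(x,r))/(π²/2 · r⁴) → θ` — holds for Euclidean `ℝ⁴` with `θ = 1`, and so does its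
conclusion: the body of the fact, instantiated at `P = EuclideanFour`, `h = euclideanMetric EuclideanFour`,
`θ = 1`, is a theorem (the case of equality `AVR = 1`, where the constant `(n/(2e)) (Γ(n/2+1) ω_n)^{-2/n}`,
`= (2eπ)⁻¹` for `n = 4`, is Weissler's sharp Euclidean one).
[cite: BaloghKristalyTripaldi2024, Thm. 1.1 and (1.4), pp. 2–3] -/
theorem sharpLogSobolevAVR_four_flatModel :
    (∀ (x : EuclideanFour) (r : NNReal), IsCompact {y : EuclideanFour |
        (euclideanMetric EuclideanFour).edist isRiemannian_euclideanMetric x y ≤ r}) ∧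
    (∀ (x : EuclideanFour) (X : TangentSpace (𝓡 4) x),
        0 ≤ (euclideanMetric EuclideanFour).ricci x X X) ∧
    (0 : ℝ) < 1 ∧
    (∀ x : EuclideanFour, Tendsto (fun r : ℝ ↦ ((riemannianMeasure
        ((euclideanMetric EuclideanFour).toContMDiffRiemannianMetric isRiemannian_euclideanMetric))
        {y : EuclideanFour | (euclideanMetric EuclideanFour).edist isRiemannian_euclideanMetric x y ≤
          ENNReal.ofReal r}).toReal / (Real.pi ^ 2 / 2 * r ^ 4)) atTop (𝓝 1)) ∧
    ∀ u : EuclideanFour → ℝ, ContMDiff (𝓡 4) 𝓘(ℝ, ℝ) ∞ u → HasCompactSupport u →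
      ∫ x, (u x) ^ 2 ∂(riemannianMeasure
        ((euclideanMetric EuclideanFour).toContMDiffRiemannianMetric isRiemannian_euclideanMetric)) = 1 →
      ∀ τ : ℝ, 0 < τ →
        ∫ x, (u x) ^ 2 * Real.log ((u x) ^ 2) ∂(riemannianMeasure
            ((euclideanMetric EuclideanFour).toContMDiffRiemannianMetric isRiemannian_euclideanMetric)) ≤
          4 * τ * ∫ x, (euclideanMetric EuclideanFour).gradSq u x ∂(riemannianMeasure
              ((euclideanMetric EuclideanFour).toContMDiffRiemannianMetric isRiemannian_euclideanMetric))
            - Real.log 1 - 2 * Real.log (4 * Real.pi * τ) - 4 :=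
  ⟨isCompact_setOf_edist_euclideanMetric_le,
    fun x X ↦ by rw [ricci_euclideanMetric]; exact le_rfl,
    one_pos, avr_euclideanFour,
    fun u hu hcu h1 _τ hτ ↦ sharpLogSobolevAVR_four_euclideanFour u hu hcu h1 hτ⟩

/-- The flat model, fed to the fact: IF `sharpLogSobolevAVR_four` holds then in particular its
`ℝ⁴` instance is the (independently proved) `sharpLogSobolevAVR_four_euclideanFour` — recorded as the
statement that the fact applies to `(ℝ⁴, δ, θ = 1)` with all its hypotheses discharged. [folklore] -/
theorem sharpLogSobolevAVR_four.euclideanFour (hfact : sharpLogSobolevAVR_four)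
    (u : EuclideanFour → ℝ) (hu : ContMDiff (𝓡 4) 𝓘(ℝ, ℝ) ∞ u) (hcu : HasCompactSupport u)
    (h1 : ∫ x, (u x) ^ 2 ∂(riemannianMeasure euclideanFourMetric) = 1) {τ : ℝ} (hτ : 0 < τ) :
    ∫ x, (u x) ^ 2 * Real.log ((u x) ^ 2) ∂(riemannianMeasure euclideanFourMetric) ≤
      4 * τ * ∫ x, (euclideanMetric EuclideanFour).gradSq u x ∂(riemannianMeasure euclideanFourMetric)
        - Real.log 1 - 2 * Real.log (4 * Real.pi * τ) - 4 :=
  hfact EuclideanFour (euclideanMetric EuclideanFour) isRiemannian_euclideanMetric 1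
    isCompact_setOf_edist_euclideanMetric_le (fun x X ↦ by rw [ricci_euclideanMetric]; exact le_rfl)
    one_pos avr_euclideanFour u hu hcu h1 τ hτ

end EuclideanFour

end Literature.Geometry.Riemannian
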